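import Summits.QuantumFields.YangMills.Theorems.FluctuationComparisonRegPrIntLSupTailModulus
import Literature.MathematicalPhysics.QuantumFieldTheory.Balaban1983to89.T4AveragingDisintegration
import Literature.MathematicalPhysics.QuantumFieldTheory.Balaban1983to89.T3TiltDescent
import HarnessLib

/-!
# `FluctuationComparisonRegPrIntLSupTailFibreOdds` — LINE g21-1 «SUP-TAIL × CRUDE LOCALITY»: COND-ODDS ⟸ FIBREWISE ODDS (the disintegration door)
# (crux `UnitScaleTilt.FluctuationComparisonRegPrIntL`, stmt-QuantumFields-20520; row TAILSUP `WindowOddsSupCan` of `Cruxes/…/Lines/suptail_split.lean` v1, ideator ym-r3-idea-1 g21)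

Cell `ym3-torus` (YM ladder rung R3 = continuum SU(2) Yang–Mills on T³ — a RUNG, NOT the Clay problem: not d = 4, not infinite volume, not a mass gap);
width seat `ym-ust-20520-w3` (gen 17); helper `--supports stmt-QuantumFields-20520`.  THEOREMS ONLY (0 `def`, 0 `sorry`, default heartbeats).  Third file of the
TAILSUP door: `…SupTailReduction` proves TAILSUP ⟸ COND-ODDS (a SETWISE inequality `Gibbs_K(D⁻¹B) ≤ e^{τ}·Gibbs_K(D⁻¹B ∩ histGood)` on the window) and
`…SupTailModulus` turns a bad FRACTION `≤ x ≤ 1∕2` into that shape with `τ = 2x`.  This file goes one level down — to the FIBRE: by the tree's one-step∕any-step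
disintegration (lit `T4AveragingDisintegration`: `jointLaw`, the conditional kernel `condLaw ν D` of the fine field given `D = V`, `fst ⊗ₘ condLaw = jointLaw`)
* §1 (generic, any finite `ν`, measurable `D : β → α`, weight `w : β → ℝ≥0∞`) ★`withDensity_preimage_inter_eq_lintegral_condLaw` —
  `(ν.withDensity w)(D⁻¹B ∩ T) = ∫⁻_{V ∈ B} (∫⁻_{U ∈ T} w dcondLaw(V)) d(ν.map D)`; ★★`badFraction_of_fibrewise` — if for `(ν.map D)`-a.e. `V ∈ W` the `w`-weighted
  conditional law puts fraction `≤ x` of its mass outside `G`, then `(ν.withDensity w)(D⁻¹B ∖ G) ≤ x·(ν.withDensity w)(D⁻¹B)` for every measurable `B ⊆ W`;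
* §2 (the runs) ★★★`condGoodOdds_of_fibrewise` — for the run-`K` Gibbs measure (`= (Z_K)⁻¹ • dU.withDensity e^{−β_K A}`) and `D = descendTo J K`: an a.e.-FIBREWISE bound
  «given the window datum `V`, the Boltzmann-weighted conditional Haar law of the fine field puts fraction `≤ x ≤ 1∕2` on bad histories» ⟹ COND-ODDS at `(J, K)`
  with `τ = 2x` — EXACTLY the hypothesis shape of ✓`…SupTailReduction.window_logOdds_bounds` ∕ `windowOddsSupCan_of_condGoodOdds`.
So a TAILSUP hand's whole obligation is now: a LARGE-DEVIATION BOUND FOR ONE EXPLICIT FIBRE LAW (at depth one: the one-step constrained measure's odds of a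
`θ(J+1)`-large fine plaquette, the card's sentence), in print's per-plaquette currency if it likes (✓`sum_perHeight_le_geometric`).
HONEST SCOPE.  Disintegration bookkeeping; no large-deviation estimate is proved; TAILSUP, LFR♯ᶜ, S2β, 20520, `YM3TorusSU2` NOT proved; the Yang–Mills mass gap is NOT proved.
References: [Balaban1985Averaging] (10) p. 19 (the one-step transformation as a fibre integral); [Balaban1985UV3] (2) p. 256, (38)–(40) p. 266.
-/

noncomputable section

set_option autoImplicit false

open MeasureTheory ProbabilityTheory Filter Topology Set
open scoped ENNReal NNReal
open Literature.MathematicalPhysics.QuantumFieldTheory.Balaban1983to89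
open Literature.MathematicalPhysics.QuantumFieldTheory.Balaban1983to89.T3ContinuumYM3Torus
open Literature.MathematicalPhysics.QuantumFieldTheory.Balaban1983to89.T3NestedUnitLaws
open Literature.MathematicalPhysics.QuantumFieldTheory.Balaban1983to89.T3UnitLawDensityEML
open Literature.MathematicalPhysics.QuantumFieldTheory.Balaban1983to89.T3UnitScaleTilt
open Literature.MathematicalPhysics.QuantumFieldTheory.Balaban1983to89.T3TiltDescent
open Literature.MathematicalPhysics.QuantumFieldTheory.Balaban1983to89.Missing
open Literature.MathematicalPhysics.QuantumFieldTheory.Balaban1983to89.T4AveragingDisintegration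
open Summit.QuantumFields.YangMills.Theorems.FluctuationComparisonRegPrIntLSupTailModulus (measure_le_exp_mul_inter_of_badFraction)

namespace Summit.QuantumFields.YangMills.Theorems.FluctuationComparisonRegPrIntLSupTailFibreOdds

/-! ## §1 Generic: a weighted measure of `D⁻¹B ∩ T` is the `B`-integral of the fibrewise weighted mass of `T` -/

section Generic

variable {α β : Type*} [MeasurableSpace α] [MeasurableSpace β] [StandardBorelSpace β] [Nonempty β]

/-- ★ **WEIGHTED MASS OF `D⁻¹B ∩ T` BY DISINTEGRATION**: for a finite `ν` on the fine space, a measurable `D : β → α`, a measurable weight `w ≥ 0` and measurable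
`B ⊆ α`, `T ⊆ β`: `(ν.withDensity w)(D⁻¹B ∩ T) = ∫⁻_{V ∈ B} (∫⁻_{U ∈ T} w U dcondLaw(V)(U)) d(ν.map D)(V)` — the graph push-forward `jointLaw ν D`, its disintegration
`(ν.map D) ⊗ₘ condLaw ν D` (lit ✓`fst_compProd_condLaw`, ✓`jointLaw_fst`) and `Measure.lintegral_compProd`. [cite: Balaban1985Averaging, (10) p.19] -/
theorem withDensity_preimage_inter_eq_lintegral_condLaw (ν : Measure β) [IsFiniteMeasure ν] {D : β → α} (hD : Measurable D)
    {w : β → ℝ≥0∞} (hw : Measurable w) {B : Set α} (hB : MeasurableSet B) {T : Set β} (hT : MeasurableSet T) :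
    (ν.withDensity w) (D ⁻¹' B ∩ T) = ∫⁻ V in B, (∫⁻ U in T, w U ∂(condLaw ν D V)) ∂(ν.map D) := by
  -- the integrand on the product
  set g : α × β → ℝ≥0∞ := fun z => (B ×ˢ T).indicator (fun z => w z.2) z with hg
  have hgm : Measurable g := (hw.comp measurable_snd).indicator (hB.prod hT)
  have hpre : MeasurableSet (D ⁻¹' B ∩ T) := (hD hB).inter hT
  -- LHS as a `ν`-integral of `g (D U, U)`
  have h1 : (ν.withDensity w) (D ⁻¹' B ∩ T) = ∫⁻ U, g (D U, U) ∂ν := by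
    rw [withDensity_apply _ hpre, ← lintegral_indicator hpre]
    refine lintegral_congr fun U => ?_
    show (D ⁻¹' B ∩ T).indicator w U = (B ×ˢ T).indicator (fun z => w z.2) (D U, U)
    by_cases h : U ∈ D ⁻¹' B ∩ T
    · have h' : (D U, U) ∈ B ×ˢ T := ⟨h.1, h.2⟩
      rw [Set.indicator_of_mem h, Set.indicator_of_mem h']
    · have h' : (D U, U) ∉ B ×ˢ T := fun h'' => h ⟨h''.1, h''.2⟩
      rw [Set.indicator_of_notMem h, Set.indicator_of_notMem h']
  -- as an integral against the joint law, then disintegrate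
  have h2 : ∫⁻ U, g (D U, U) ∂ν = ∫⁻ z, g z ∂(jointLaw ν D) := by
    rw [jointLaw, lintegral_map hgm (measurable_graphMap hD)]
  have h3 : ∫⁻ z, g z ∂(jointLaw ν D) = ∫⁻ V, ∫⁻ U, g (V, U) ∂(condLaw ν D V) ∂(ν.map D) := by
    conv_lhs => rw [← fst_compProd_condLaw ν D]
    rw [Measure.lintegral_compProd hgm, jointLaw_fst ν hD]
  rw [h1, h2, h3, ← lintegral_indicator hB]
  refine lintegral_congr fun V => ?_
  by_cases hV : V ∈ B
  · rw [Set.indicator_of_mem hV, ← lintegral_indicator hT]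
    refine lintegral_congr fun U => ?_
    by_cases hU : U ∈ T
    · simp [hg, Set.indicator_of_mem, hV, hU]
    · simp [hg, hU]
  · rw [Set.indicator_of_notMem hV]
    have : ∀ U, g (V, U) = 0 := fun U => by simp [hg, hV]
    simp [this]

/-- ★★ **A FIBREWISE BAD FRACTION IS A SETWISE BAD FRACTION**: if for `(ν.map D)`-almost every `V ∈ W` the `w`-weighted conditional law of the fine variable given
`D = V` puts at most the fraction `x` of its mass outside `G`, then for every measurable `B ⊆ W`:
`(ν.withDensity w)(D⁻¹B ∖ G) ≤ x·(ν.withDensity w)(D⁻¹B)`. [cite: Balaban1985Averaging, (10) p.19; Balaban1985UV3, (38)-(40) p.266] -/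
theorem badFraction_of_fibrewise (ν : Measure β) [IsFiniteMeasure ν] {D : β → α} (hD : Measurable D) {w : β → ℝ≥0∞} (hw : Measurable w)
    {W : Set α} {G : Set β} (hG : MeasurableSet G) {x : ℝ≥0∞}
    (hfib : ∀ᵐ V ∂(ν.map D), V ∈ W → ∫⁻ U in Gᶜ, w U ∂(condLaw ν D V) ≤ x * ∫⁻ U, w U ∂(condLaw ν D V)) :
    ∀ B : Set α, MeasurableSet B → B ⊆ W → (ν.withDensity w) (D ⁻¹' B \ G) ≤ x * (ν.withDensity w) (D ⁻¹' B) := by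
  intro B hB hBW
  rw [show D ⁻¹' B \ G = D ⁻¹' B ∩ Gᶜ from rfl, withDensity_preimage_inter_eq_lintegral_condLaw ν hD hw hB hG.compl]
  have huniv : (ν.withDensity w) (D ⁻¹' B) = ∫⁻ V in B, (∫⁻ U, w U ∂(condLaw ν D V)) ∂(ν.map D) := by
    rw [← Set.inter_univ (D ⁻¹' B), withDensity_preimage_inter_eq_lintegral_condLaw ν hD hw hB MeasurableSet.univ]
    simp only [Measure.restrict_univ]
  rw [huniv, ← lintegral_const_mul x hw.lintegral_kernel]
  exact setLIntegral_mono_ae' hB (by filter_upwards [hfib] with V hV hVB using hV (hBW hVB))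

end Generic

/-! ## §2 The runs: a fibrewise bad fraction for the Boltzmann-weighted conditional Haar law ⇒ COND-ODDS at `(J, K)` -/

section Runs

variable (F : T3Family) {γ : ℝ} (b₀ p₀ : ℝ) {J K : ℕ} (hJK : J ≤ K)

/-- The run-`K` Gibbs measure IS the normalised Boltzmann-weighted product Haar measure (`gibbsK` ∕ `gibbsMeasure` unfolded). [cite: Balaban1985UV3, (1)-(3) p.256] -/
theorem gibbsK_eq_smul_withDensity (γ : ℝ) (K : ℕ) :
    gibbsK F ℰp γ K =
      (ENNReal.ofReal (partitionFn (G := Matrix.specialUnitaryGroup (Fin 2) ℂ) (F.P K) ((F.scheme ℰp γ).β K)))⁻¹ •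
        (fieldMeasure (F.P K) 0 (Matrix.specialUnitaryGroup (Fin 2) ℂ)).withDensity
          (fun U => ENNReal.ofReal (boltzmann (F.P K) ((F.scheme ℰp γ).β K) U)) := by
  rw [gibbsK_eq]
  rfl

/-- ★★★ **COND-ODDS AT `(J, K)` ⟸ A FIBREWISE BAD FRACTION** (the hands' target, fibre currency): if for `(dU.map D_{J,K})`-almost every window datum `V`
(`PlaqSmall θ_J V`) the Boltzmann-weighted conditional Haar law of the run-`K` fine field given `D_{J,K} = V` (lit `condLaw (fieldMeasure (F.P K) 0) (descendTo J K)`)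
puts at most the fraction `x` (`0 ≤ x ≤ 1∕2`) of its mass on BAD histories `(histGood K J)ᶜ`, then for every measurable `B` inside the window
`Gibbs_K(D⁻¹B) ≤ e^{2x}·Gibbs_K(D⁻¹B ∩ histGood K J)` — the hypothesis shape of ✓`…SupTailReduction.window_logOdds_bounds` with `τ = 2x`.
(§1 for product Haar with the Boltzmann weight; the normalisation `Z_K⁻¹` cancels; ✓`…SupTailModulus.measure_le_exp_mul_inter_of_badFraction`.)
[cite: Balaban1985UV3, (38)-(40) p.266; Balaban1985Averaging, (10) p.19] -/
theorem condGoodOdds_of_fibrewise (hγ : 0 ≤ γ) {x : ℝ} (hx0 : 0 ≤ x) (hx : x ≤ 1 / 2)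
    (hfib : ∀ᵐ V ∂((fieldMeasure (F.P K) 0 (Matrix.specialUnitaryGroup (Fin 2) ℂ)).map (descendTo F ℰp J K hJK)),
      PlaqSmall (θBal F.L γ b₀ p₀ J) V →
        ∫⁻ U in (histGood F ℰp (θBal F.L γ b₀ p₀) K J)ᶜ, ENNReal.ofReal (boltzmann (F.P K) ((F.scheme ℰp γ).β K) U)
            ∂(condLaw (fieldMeasure (F.P K) 0 (Matrix.specialUnitaryGroup (Fin 2) ℂ)) (descendTo F ℰp J K hJK) V) ≤
          ENNReal.ofReal x * ∫⁻ U, ENNReal.ofReal (boltzmann (F.P K) ((F.scheme ℰp γ).β K) U)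
            ∂(condLaw (fieldMeasure (F.P K) 0 (Matrix.specialUnitaryGroup (Fin 2) ℂ)) (descendTo F ℰp J K hJK) V)) :
    ∀ B : Set (GaugeField (F.P J) 0 (Matrix.specialUnitaryGroup (Fin 2) ℂ)), MeasurableSet B →
      B ⊆ {U | PlaqSmall (θBal F.L γ b₀ p₀ J) U} →
      gibbsK F ℰp γ K (descendTo F ℰp J K hJK ⁻¹' B) ≤
        ENNReal.ofReal (Real.exp (2 * x)) * gibbsK F ℰp γ K (descendTo F ℰp J K hJK ⁻¹' B ∩ histGood F ℰp (θBal F.L γ b₀ p₀) K J) := by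
  intro B hB hBW
  haveI := isProbabilityMeasure_gibbsK F ℰp hγ K
  have hD : Measurable (descendTo F ℰp J K hJK) := measurable_descendTo F ℰp measurableE_ℰp hJK
  have hGm : MeasurableSet (histGood F ℰp (θBal F.L γ b₀ p₀) K J) := measurableSet_histGood F ℰp measurableE_ℰp _ K J
  have hw : Measurable fun U : GaugeField (F.P K) 0 (Matrix.specialUnitaryGroup (Fin 2) ℂ) =>
      ENNReal.ofReal (boltzmann (F.P K) ((F.scheme ℰp γ).β K) U) := (measurable_boltzmann RegularGaugeGroup.measurable_reTr _ _).ennreal_ofReal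
  -- setwise bad fraction for the weighted Haar measure, then for its scalar multiple `gibbsK`
  have hbad := badFraction_of_fibrewise (fieldMeasure (F.P K) 0 (Matrix.specialUnitaryGroup (Fin 2) ℂ)) hD hw hGm hfib B hB hBW
  have hbadG : gibbsK F ℰp γ K (descendTo F ℰp J K hJK ⁻¹' B \ histGood F ℰp (θBal F.L γ b₀ p₀) K J) ≤
      ENNReal.ofReal x * gibbsK F ℰp γ K (descendTo F ℰp J K hJK ⁻¹' B) := by
    rw [gibbsK_eq_smul_withDensity]
    simp only [Measure.smul_apply, smul_eq_mul]
    rw [mul_left_comm]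
    exact mul_le_mul' le_rfl hbad
  exact measure_le_exp_mul_inter_of_badFraction (gibbsK F ℰp γ K) hGm hx0 hx hbadG

end Runs

end Summit.QuantumFields.YangMills.Theorems.FluctuationComparisonRegPrIntLSupTailFibreOdds

end
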